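import Mathlib.Tactic
import HarnessLib
import HarnessLib.Audit.Tags
import Summits.CriticalPhenomena.PercolationContinuityZ3.Theorems.PercNearOneGluingNoHeavyLowerTailSahiAntichainSplit

/-!
# Antichains, meets plus joins: complement duality and the difference-free projection

Support file (seat `prim-masterthm-p1`, gen 36; `--supports stmt-CriticalPhenomena-4575`).  No `sorry`, no new definitions, standard
axioms.  Memo `run/shared/lean/prim/prim-masterthm/FROM-prim-masterthm-p1-g36-*.md`.

SETTING (files `…SahiAntichainSplit*`).  For a finite family `P` of finite sets, `meets P` / `joins P` are the pairwise meets / joins of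
DISTINCT members, `above P r` / `below P r` the members containing / avoiding the point `r`, and `newLabels P r` counts the cross labels
created by the split at `r`.  Conjecture V5: an antichain has `#meets P + #joins P ≥ 2 #P − 2`.

NEW HERE ([this work], gen 36) — **complement duality**, infrastructure for the V5 induction.  For `F ⊇ ⋃ P` the relative
complement `a ↦ F \ a` maps `P` onto an antichain `P.image (F \ ·)` of the same size, exchanging `meets ↔ joins`, `above ↔ below`
(for `r ∈ F`), `crossMeets ↔ crossJoins`, `#newMeets ↔ #newJoins`, and fixing `newLabels` (`newLabels_image_compl`).  Every
one-sided statement about the split (two-member step, uniform-join step, the sunflower step, …) therefore yields its dual for free;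
as a first use the one-sided step `two_le_newLabels_of_card_below_eq_one` of `…SahiAntichainSplit` is RE-DERIVED from
`…_above_eq_one` in three lines (`two_le_newLabels_of_card_below_eq_one'`).  Companion file `…SahiAntichainProject`: the
difference-free projection (a minimal counterexample to V5 has every point a singleton difference).
HONEST FRAMING: V5 itself remains OPEN; everything here is unconditional bookkeeping. [this work]
-/

namespace Summit.CriticalPhenomena.PercolationContinuityZ3.Theorems.SahiColouredDaykin

open Finset

variable {α : Type*} [DecidableEq α]

/-! ### 0. Small image lemmas -/

/-- Two subsets of `F` with the same complement in `F` are equal. [this work] -/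
theorem eq_of_sdiff_eq {F a b : Finset α} (ha : a ⊆ F) (hb : b ⊆ F) (h : F \ a = F \ b) : a = b := by
  rw [← Finset.sdiff_sdiff_eq_self ha, h, Finset.sdiff_sdiff_eq_self hb]

/-- Relative complement is injective on a family of subsets of `F`. [this work] -/
theorem sdiff_injOn_subsets (F : Finset α) {S : Finset (Finset α)} (hS : ∀ a ∈ S, a ⊆ F) :
    Set.InjOn (fun a : Finset α => F \ a) (S : Set (Finset α)) :=
  fun a ha b hb hab => eq_of_sdiff_eq (hS a (mem_coe.1 ha)) (hS b (mem_coe.1 hb)) hab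

/-- Image of a set difference under a map injective on the union. [this work] -/
theorem image_sdiff_of_injOn_union {β : Type*} [DecidableEq β] {f : Finset α → β} {s t : Finset (Finset α)}
    (hf : Set.InjOn f ((s ∪ t : Finset (Finset α)) : Set (Finset α))) : (s \ t).image f = s.image f \ t.image f := by
  ext y
  simp only [mem_image, mem_sdiff]
  constructor
  · rintro ⟨x, ⟨hxs, hxt⟩, rfl⟩
    refine ⟨⟨x, hxs, rfl⟩, ?_⟩
    rintro ⟨x', hx't, hx'x⟩
    have : x' = x := hf (mem_coe.2 (mem_union_right _ hx't)) (mem_coe.2 (mem_union_left _ hxs)) hx'x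
    exact hxt (this ▸ hx't)
  · rintro ⟨⟨x, hxs, rfl⟩, hnot⟩
    exact ⟨x, ⟨hxs, fun hxt => hnot ⟨x, hxt, rfl⟩⟩, rfl⟩

/-- Members of `meets P` lie inside `F` when the members of `P` do. [this work] -/
theorem meets_subset_of_subset {P : Finset (Finset α)} {F : Finset α} (hP : ∀ a ∈ P, a ⊆ F) :
    ∀ Z ∈ meets P, Z ⊆ F := by
  intro Z hZ
  obtain ⟨a, ha, b, _, _, rfl⟩ := mem_meets_iff.1 hZ
  exact inter_subset_left.trans (hP a ha)

/-- Members of `joins P` lie inside `F` when the members of `P` do. [this work] -/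
theorem joins_subset_of_subset {P : Finset (Finset α)} {F : Finset α} (hP : ∀ a ∈ P, a ⊆ F) :
    ∀ W ∈ joins P, W ⊆ F := by
  intro W hW
  obtain ⟨a, ha, b, hb, _, rfl⟩ := mem_joins_iff.1 hW
  exact union_subset (hP a ha) (hP b hb)

/-- Members of `crossMeets P r` lie inside `F` when the members of `P` do. [this work] -/
theorem crossMeets_subset_of_subset {P : Finset (Finset α)} {F : Finset α} {r : α} (hP : ∀ a ∈ P, a ⊆ F) :
    ∀ Z ∈ crossMeets P r, Z ⊆ F := by
  intro Z hZ
  obtain ⟨a, ha, b, _, _, _, rfl⟩ := mem_crossMeets_iff.1 hZ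
  exact inter_subset_left.trans (hP a ha)

/-- Members of `crossJoins P r` lie inside `F` when the members of `P` do. [this work] -/
theorem crossJoins_subset_of_subset {P : Finset (Finset α)} {F : Finset α} {r : α} (hP : ∀ a ∈ P, a ⊆ F) :
    ∀ W ∈ crossJoins P r, W ⊆ F := by
  intro W hW
  obtain ⟨a, ha, b, hb, _, _, rfl⟩ := mem_crossJoins_iff.1 hW
  exact union_subset (hP a ha) (hP b hb)

/-! ### 1. Complement duality -/

section Compl

variable {P : Finset (Finset α)} {F : Finset α}

/-- The complemented family has the same number of members. [this work] -/
theorem card_image_compl (hP : ∀ a ∈ P, a ⊆ F) : #(P.image (F \ ·)) = #P :=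
  card_image_of_injOn (sdiff_injOn_subsets F hP)

/-- The members of the complemented family lie inside `F`. [this work] -/
theorem subset_of_mem_image_compl : ∀ x ∈ P.image (F \ ·), x ⊆ F := by
  intro x hx
  obtain ⟨a, _, rfl⟩ := mem_image.1 hx
  exact sdiff_subset

/-- Complementing twice returns the family. [this work] -/
theorem image_compl_image_compl (hP : ∀ a ∈ P, a ⊆ F) : (P.image (F \ ·)).image (F \ ·) = P := by
  rw [image_image]
  have : ∀ a ∈ P, ((fun x : Finset α => F \ x) ∘ fun x : Finset α => F \ x) a = a := fun a ha => by
    simp only [Function.comp, Finset.sdiff_sdiff_eq_self (hP a ha)]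
  rw [image_congr (show Set.EqOn _ id (P : Set (Finset α)) from fun a ha => this a (mem_coe.1 ha)), image_id]

/-- The complemented family of an antichain is an antichain. [this work] -/
theorem isAntichain_image_compl (hanti : IsAntichain (· ⊆ ·) (P : Set (Finset α))) (hP : ∀ a ∈ P, a ⊆ F) :
    IsAntichain (· ⊆ ·) (P.image (F \ ·) : Set (Finset α)) := by
  intro x hx y hy hxy hsub
  obtain ⟨a, ha, rfl⟩ := mem_image.1 (mem_coe.1 hx)
  obtain ⟨b, hb, rfl⟩ := mem_image.1 (mem_coe.1 hy)
  have hba : b ⊆ a := by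
    intro z hz
    by_contra hza
    have : z ∈ F \ a := mem_sdiff.2 ⟨hP b hb hz, hza⟩
    exact (mem_sdiff.1 (hsub this)).2 hz
  have hne : b ≠ a := by rintro rfl; exact hxy rfl
  exact hanti (mem_coe.2 hb) (mem_coe.2 ha) hne hba

/-- Meets of the complemented family are the complements of the joins. [this work] -/
theorem meets_image_compl (hP : ∀ a ∈ P, a ⊆ F) : meets (P.image (F \ ·)) = (joins P).image (F \ ·) := by
  ext Z
  simp only [mem_meets_iff, mem_joins_iff, mem_image]
  constructor
  · rintro ⟨x, ⟨a, ha, rfl⟩, y, ⟨b, hb, rfl⟩, hxy, rfl⟩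
    refine ⟨a ∪ b, ⟨a, ha, b, hb, ?_, rfl⟩, sdiff_union_distrib F a b⟩
    rintro rfl; exact hxy rfl
  · rintro ⟨W, ⟨a, ha, b, hb, hab, rfl⟩, rfl⟩
    refine ⟨F \ a, ⟨a, ha, rfl⟩, F \ b, ⟨b, hb, rfl⟩, ?_, sdiff_union_distrib F a b⟩
    exact fun h => hab (eq_of_sdiff_eq (hP a ha) (hP b hb) h)

/-- Joins of the complemented family are the complements of the meets. [this work] -/
theorem joins_image_compl (hP : ∀ a ∈ P, a ⊆ F) : joins (P.image (F \ ·)) = (meets P).image (F \ ·) := by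
  ext W
  simp only [mem_meets_iff, mem_joins_iff, mem_image]
  constructor
  · rintro ⟨x, ⟨a, ha, rfl⟩, y, ⟨b, hb, rfl⟩, hxy, rfl⟩
    refine ⟨a ∩ b, ⟨a, ha, b, hb, ?_, rfl⟩, sdiff_inter_distrib_right F a b⟩
    rintro rfl; exact hxy rfl
  · rintro ⟨Z, ⟨a, ha, b, hb, hab, rfl⟩, rfl⟩
    refine ⟨F \ a, ⟨a, ha, rfl⟩, F \ b, ⟨b, hb, rfl⟩, ?_, sdiff_inter_distrib_right F a b⟩
    exact fun h => hab (eq_of_sdiff_eq (hP a ha) (hP b hb) h)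

/-- `#meets` of the complemented family is `#joins` of the family. [this work] -/
theorem card_meets_image_compl (hP : ∀ a ∈ P, a ⊆ F) : #(meets (P.image (F \ ·))) = #(joins P) := by
  rw [meets_image_compl hP]
  exact card_image_of_injOn (sdiff_injOn_subsets F (joins_subset_of_subset hP))

/-- `#joins` of the complemented family is `#meets` of the family. [this work] -/
theorem card_joins_image_compl (hP : ∀ a ∈ P, a ⊆ F) : #(joins (P.image (F \ ·))) = #(meets P) := by
  rw [joins_image_compl hP]
  exact card_image_of_injOn (sdiff_injOn_subsets F (meets_subset_of_subset hP))

/-- `f = #meets + #joins` is invariant under complementation. [this work] -/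
theorem card_meets_add_card_joins_image_compl (hP : ∀ a ∈ P, a ⊆ F) :
    #(meets (P.image (F \ ·))) + #(joins (P.image (F \ ·))) = #(meets P) + #(joins P) := by
  rw [card_meets_image_compl hP, card_joins_image_compl hP, Nat.add_comm]

variable {r : α}

/-- `above` of the complemented family is the complement of `below` (for `r ∈ F`). [this work] -/
theorem above_image_compl (hr : r ∈ F) :
    above (P.image (F \ ·)) r = (below P r).image (F \ ·) := by
  ext x
  simp only [mem_above_iff, mem_below_iff, mem_image]
  constructor
  · rintro ⟨⟨a, ha, rfl⟩, hrx⟩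
    exact ⟨a, ⟨ha, (mem_sdiff.1 hrx).2⟩, rfl⟩
  · rintro ⟨a, ⟨ha, hra⟩, rfl⟩
    exact ⟨⟨a, ha, rfl⟩, mem_sdiff.2 ⟨hr, hra⟩⟩

/-- `below` of the complemented family is the complement of `above` (for `r ∈ F`). [this work] -/
theorem below_image_compl (hr : r ∈ F) :
    below (P.image (F \ ·)) r = (above P r).image (F \ ·) := by
  ext x
  simp only [mem_above_iff, mem_below_iff, mem_image]
  constructor
  · rintro ⟨⟨a, ha, rfl⟩, hrx⟩
    refine ⟨a, ⟨ha, ?_⟩, rfl⟩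
    by_contra hra
    exact hrx (mem_sdiff.2 ⟨hr, hra⟩)
  · rintro ⟨a, ⟨ha, hra⟩, rfl⟩
    exact ⟨⟨a, ha, rfl⟩, fun h => (mem_sdiff.1 h).2 hra⟩

/-- Cross meets of the complemented family are the complements of the cross joins. [this work] -/
theorem crossMeets_image_compl (hr : r ∈ F) :
    crossMeets (P.image (F \ ·)) r = (crossJoins P r).image (F \ ·) := by
  ext Z
  simp only [mem_crossMeets_iff, mem_crossJoins_iff, mem_image]
  constructor
  · rintro ⟨x, ⟨a, ha, rfl⟩, y, ⟨b, hb, rfl⟩, hrx, hry, rfl⟩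
    -- x = F \ a contains r ⇒ r ∉ a; y = F \ b avoids r ⇒ r ∈ b
    refine ⟨b ∪ a, ⟨b, hb, a, ha, ?_, (mem_sdiff.1 hrx).2, rfl⟩, ?_⟩
    · by_contra hrb; exact hry (mem_sdiff.2 ⟨hr, hrb⟩)
    · rw [sdiff_union_distrib, inter_comm]
  · rintro ⟨W, ⟨a, ha, b, hb, hra, hrb, rfl⟩, rfl⟩
    refine ⟨F \ b, ⟨b, hb, rfl⟩, F \ a, ⟨a, ha, rfl⟩, mem_sdiff.2 ⟨hr, hrb⟩, fun h => (mem_sdiff.1 h).2 hra, ?_⟩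
    rw [sdiff_union_distrib, inter_comm]

/-- Cross joins of the complemented family are the complements of the cross meets. [this work] -/
theorem crossJoins_image_compl (hr : r ∈ F) :
    crossJoins (P.image (F \ ·)) r = (crossMeets P r).image (F \ ·) := by
  ext W
  simp only [mem_crossMeets_iff, mem_crossJoins_iff, mem_image]
  constructor
  · rintro ⟨x, ⟨a, ha, rfl⟩, y, ⟨b, hb, rfl⟩, hrx, hry, rfl⟩
    refine ⟨b ∩ a, ⟨b, hb, a, ha, ?_, (mem_sdiff.1 hrx).2, rfl⟩, ?_⟩
    · by_contra hrb; exact hry (mem_sdiff.2 ⟨hr, hrb⟩)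
    · rw [sdiff_inter_distrib_right, union_comm]
  · rintro ⟨Z, ⟨a, ha, b, hb, hra, hrb, rfl⟩, rfl⟩
    refine ⟨F \ b, ⟨b, hb, rfl⟩, F \ a, ⟨a, ha, rfl⟩, mem_sdiff.2 ⟨hr, hrb⟩, fun h => (mem_sdiff.1 h).2 hra, ?_⟩
    rw [sdiff_inter_distrib_right, union_comm]

/-- `#newMeets` of the complemented family is `#newJoins` of the family. [this work] -/
theorem card_newMeets_image_compl (hP : ∀ a ∈ P, a ⊆ F) (hr : r ∈ F) :
    #(newMeets (P.image (F \ ·)) r) = #(newJoins P r) := by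
  unfold newMeets newJoins
  rw [crossMeets_image_compl (P := P) hr, below_image_compl (P := P) hr, meets_image_compl (fun a ha => hP a (above_subset P r ha)),
    ← image_sdiff_of_injOn_union, card_image_of_injOn]
  · exact sdiff_injOn_subsets F fun W hW =>
      crossJoins_subset_of_subset hP W (mem_sdiff.1 hW).1
  · apply sdiff_injOn_subsets F
    intro W hW
    rcases mem_union.1 hW with hW | hW
    · exact crossJoins_subset_of_subset hP W hW
    · exact joins_subset_of_subset (fun a ha => hP a (above_subset P r ha)) W hW

/-- `#newJoins` of the complemented family is `#newMeets` of the family. [this work] -/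
theorem card_newJoins_image_compl (hP : ∀ a ∈ P, a ⊆ F) (hr : r ∈ F) :
    #(newJoins (P.image (F \ ·)) r) = #(newMeets P r) := by
  unfold newMeets newJoins
  rw [crossJoins_image_compl (P := P) hr, above_image_compl (P := P) hr, joins_image_compl (fun a ha => hP a (below_subset P r ha)),
    ← image_sdiff_of_injOn_union, card_image_of_injOn]
  · exact sdiff_injOn_subsets F fun Z hZ =>
      crossMeets_subset_of_subset hP Z (mem_sdiff.1 hZ).1
  · apply sdiff_injOn_subsets F
    intro Z hZ
    rcases mem_union.1 hZ with hZ | hZ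
    · exact crossMeets_subset_of_subset hP Z hZ
    · exact meets_subset_of_subset (fun a ha => hP a (below_subset P r ha)) Z hZ

/-- **`newLabels` is invariant under complementation.** [this work] -/
theorem newLabels_image_compl (hP : ∀ a ∈ P, a ⊆ F) (hr : r ∈ F) :
    newLabels (P.image (F \ ·)) r = newLabels P r := by
  unfold newLabels
  rw [card_newMeets_image_compl hP hr, card_newJoins_image_compl hP hr, Nat.add_comm]

/-- `#above` of the complemented family is `#below` of the family. [this work] -/
theorem card_above_image_compl (hP : ∀ a ∈ P, a ⊆ F) (hr : r ∈ F) :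
    #(above (P.image (F \ ·)) r) = #(below P r) := by
  rw [above_image_compl (P := P) hr]
  exact card_image_of_injOn (sdiff_injOn_subsets F fun a ha => hP a (below_subset P r ha))

/-- `#below` of the complemented family is `#above` of the family. [this work] -/
theorem card_below_image_compl (hP : ∀ a ∈ P, a ⊆ F) (hr : r ∈ F) :
    #(below (P.image (F \ ·)) r) = #(above P r) := by
  rw [below_image_compl (P := P) hr]
  exact card_image_of_injOn (sdiff_injOn_subsets F fun a ha => hP a (above_subset P r ha))

/-- A convenient universe: every member lies inside `insert r (P.sup id)`. [this work] -/
theorem subset_insert_sup (P : Finset (Finset α)) (r : α) : ∀ a ∈ P, a ⊆ insert r (P.sup id) :=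
  fun _ ha => (le_sup (f := id) ha).trans (subset_insert _ _)

/-- **Duality in use**: the dual one-sided step, re-derived from `two_le_newLabels_of_card_above_eq_one` by complementation
(compare the direct proof `two_le_newLabels_of_card_below_eq_one` in `…SahiAntichainSplit`). [this work] -/
theorem two_le_newLabels_of_card_below_eq_one' {P : Finset (Finset α)} {r : α}
    (hanti : IsAntichain (· ⊆ ·) (P : Set (Finset α))) (h2 : 2 ≤ #P) (h1 : #(below P r) = 1) :
    2 ≤ newLabels P r := by
  set F := insert r (P.sup id) with hF
  have hP : ∀ a ∈ P, a ⊆ F := subset_insert_sup P r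
  have hr : r ∈ F := mem_insert_self _ _
  rw [← newLabels_image_compl hP hr]
  exact two_le_newLabels_of_card_above_eq_one (isAntichain_image_compl hanti hP) (by rw [card_image_compl hP]; exact h2)
    (by rw [card_above_image_compl hP hr]; exact h1)

end Compl

end Summit.CriticalPhenomena.PercolationContinuityZ3.Theorems.SahiColouredDaykin
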